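import Summits.RiemannHypothesis.RiemannHypothesis.Theorems.JensenPolynomialsFarGumbelDefs
import Summits.RiemannHypothesis.RiemannHypothesis.Theorems.JensenPolynomialsSkewFarMoments

/-!
# Route `JensenPolynomials`, FAR crux `XiWindowZeroFreeRelFar` (B1-rel far) — line «far-gumbel»: the envelope mode `υ`
versus the true tilted mode `a = xiMode(2M)`, and the TWO-SIDED window law for `c_M = μ_{2M}/μ_{2M−2}`
(RH-FREE; cell rh-jensen, HUMAN RULING D-0040; helper for stubs S2 `stub_junk` and S5 `stub_cubicTransfer` of item
`stmt-RiemannHypothesis-19465`)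

The far-Gumbel skeleton (theory g8, v3) quantifies over the ENVELOPE MODE `υ ≥ 189/20` with `4πe^{4υ}υ = 2M + 9υ` (the
mode of `e^{9u − πe^{4u}}u^{2M}`), while prover g4's Stein-moment engine (`SkewFar*`, 19466) works at the TRUE MODE
`a = xiMode(2M)` of `Φ(u)u^{2M}` (`a·(−Φ′/Φ)(a) = 2M`). From the envelopes `a(4πe^{4a} − 9.005) ≤ 2M ≤ a(4πe^{4a} − 9)`
(`Literature…XiTiltedPotentialTails.xiMode_mul_envelope_bounds`) and the monotonicity of `τ ↦ τ(4πe^{4τ} − κ)`: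

* `υ ≤ a ≤ (1 + 10⁻⁹)υ` (`envMode_le_xiMode`, `xiMode_le_envMode_mul`);

and from prover g4's LANDED first-moment law `|P − (2c/R + 3/a)| ≤ 0.011`, `P = a³R(μ_{2M−2}/μ_{2M} − 1/a²)`, `R ≥ 10¹⁷`,
`0 < c ≤ 2R` (`SkewFar.P_bound`, `consts_facts`, `R_large`):

* `c_M = a²/(1 + P/(aR))` with `−0.011 ≤ P ≤ 4.34`, hence `|c_M − a²| ≤ a²·10⁻¹⁶` and **`|c_M − υ²| ≤ υ²·10⁻⁸`**
  (`abs_cM_sub_sq_le`) — the TWO-SIDED law S5's `cubicTransfer_of_windowLaws` (p446069) consumes with tolerance `υ²/4000`,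
  and the upper bound S2 uses to place `z̃ = a_s/υ²` in the disc `|z̃| ≤ 0.3502`.

WHAT THIS IS NOT: elementary bookkeeping between two modes of the same tilted law; nothing here bears on the zeros of `ζ`
or the truth of RH. References: [GORZPNAS2019]; Coffey–Csordas 2013 (the `Φ` envelopes) [CoffeyCsordas2013].
-/

noncomputable section
-- D-0017: `Summit.RiemannHypothesis.RiemannHypothesis.…` duplicates the namespace BY DESIGN (single-problem summit).
set_option linter.dupNamespace false

namespace Summit.RiemannHypothesis.RiemannHypothesis.Theorems.JensenPolynomials.FarGumbel

open Literature.NumberTheory.LFunctions Real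
open Summit.RiemannHypothesis.RiemannHypothesis.Theorems.JensenPolynomials.SkewFar

/-! ## 1. Monotonicity of the envelope functions `τ ↦ τ(4πe^{4τ} − κ)` -/

/-- For `κ ≤ 4π` the map `τ ↦ τ·(4πe^{4τ} − κ)` is monotone on `[0, ∞)`. -/
theorem envFun_mono {κ τ₁ τ₂ : ℝ} (hκ : κ ≤ 4 * π) (h0 : 0 ≤ τ₁) (h12 : τ₁ ≤ τ₂) :
    τ₁ * (4 * π * exp (4 * τ₁) - κ) ≤ τ₂ * (4 * π * exp (4 * τ₂) - κ) := by
  have he : exp (4 * τ₁) ≤ exp (4 * τ₂) := exp_le_exp.mpr (by linarith)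
  have he1 : 1 ≤ exp (4 * τ₁) := by
    have : (0 : ℝ) ≤ 4 * τ₁ := by linarith
    simpa using exp_le_exp.mpr this
  have hpos : 0 ≤ 4 * π * exp (4 * τ₁) - κ := by nlinarith [pi_pos]
  calc τ₁ * (4 * π * exp (4 * τ₁) - κ) ≤ τ₂ * (4 * π * exp (4 * τ₁) - κ) :=
        mul_le_mul_of_nonneg_right h12 hpos
    _ ≤ τ₂ * (4 * π * exp (4 * τ₂) - κ) := by
        apply mul_le_mul_of_nonneg_left _ (h0.trans h12)
        nlinarith [pi_pos]

/-! ## 2. The envelope mode against the true mode -/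

/-- **`υ ≤ a`**: the envelope mode is below the true mode `a = xiMode(2M)`. -/
theorem envMode_le_xiMode (M : ℕ) (hM : 2 * 10 ^ 18 ≤ M) {υ : ℝ}
    (hυ : (189 / 20 : ℝ) ≤ υ ∧ 4 * π * exp (4 * υ) * υ = 2 * (M : ℝ) + 9 * υ) :
    υ ≤ xiMode (((2 * M : ℕ)) : ℝ) := by
  have h2M : (((2 * M : ℕ)) : ℝ) = 2 * (M : ℝ) := by push_cast; ring
  rw [h2M]
  have hs : (0 : ℝ) < 2 * (M : ℝ) := by
    have : (2 * 10 ^ 18 : ℝ) ≤ M := by exact_mod_cast hM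
    linarith
  have ha0 := xiMode_pos hs
  set a := xiMode (2 * (M : ℝ)) with ha_def
  obtain ⟨hlow, -⟩ := xiMode_mul_envelope_bounds hs
  by_contra hlt
  push Not at hlt
  have hpos : 0 < 4 * π * exp (4 * a) - 9 := by
    have : 1 ≤ exp (4 * a) := by simpa using exp_le_exp.mpr (show (0:ℝ) ≤ 4 * a by linarith)
    nlinarith [pi_gt_three]
  have he : exp (4 * a) ≤ exp (4 * υ) := exp_le_exp.mpr (by linarith)
  have hstrict : a * (4 * π * exp (4 * a) - 9) < υ * (4 * π * exp (4 * υ) - 9) := by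
    calc a * (4 * π * exp (4 * a) - 9) < υ * (4 * π * exp (4 * a) - 9) :=
          mul_lt_mul_of_pos_right hlt hpos
      _ ≤ υ * (4 * π * exp (4 * υ) - 9) := by
          apply mul_le_mul_of_nonneg_left _ (by linarith)
          nlinarith [pi_pos]
  have hgυ : υ * (4 * π * exp (4 * υ) - 9) = 2 * (M : ℝ) := by linarith [hυ.2]
  linarith

/-- **`a ≤ (1 + 10⁻⁹)υ`**: the true mode exceeds the envelope mode by a relative `10⁻⁹` at most
(in truth by `≈ 10⁻²⁰`; from `a(4πe^{4a} − 9.005) ≤ 2M`). -/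
theorem xiMode_le_envMode_mul (M : ℕ) (hM : 2 * 10 ^ 18 ≤ M) {υ : ℝ}
    (hυ : (189 / 20 : ℝ) ≤ υ ∧ 4 * π * exp (4 * υ) * υ = 2 * (M : ℝ) + 9 * υ) :
    xiMode (((2 * M : ℕ)) : ℝ) ≤ (1 + 1 / 10 ^ 9) * υ := by
  have hυa : υ ≤ xiMode (((2 * M : ℕ)) : ℝ) := envMode_le_xiMode M hM hυ
  have h2M : (((2 * M : ℕ)) : ℝ) = 2 * (M : ℝ) := by push_cast; ring
  rw [h2M] at hυa ⊢
  have hMr : (2 * 10 ^ 18 : ℝ) ≤ M := by exact_mod_cast hM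
  have hs : (0 : ℝ) < 2 * (M : ℝ) := by linarith
  have ha0 := xiMode_pos hs
  set a := xiMode (2 * (M : ℝ)) with ha_def
  obtain ⟨-, hup⟩ := xiMode_mul_envelope_bounds hs
  have hup' := hup (by linarith [hυ.1])
  by_contra hlt
  push Not at hlt
  set υ' : ℝ := (1 + 1 / 10 ^ 9) * υ with hυ'
  have hυ0 : 0 < υ := by linarith [hυ.1]
  have hυ'0 : 0 ≤ υ' := by rw [hυ']; positivity
  have hmono := envFun_mono (κ := 9.005) (by linarith [pi_gt_d2]) hυ'0 hlt.le
  -- `e^{4υ'} ≥ e^{4υ}(1 + 4(υ'−υ))`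
  have hexp : exp (4 * υ) * (1 + 4 * (υ' - υ)) ≤ exp (4 * υ') := by
    have h1 : 1 + 4 * (υ' - υ) ≤ exp (4 * (υ' - υ)) := by
      have := add_one_le_exp (4 * (υ' - υ)); linarith
    calc exp (4 * υ) * (1 + 4 * (υ' - υ)) ≤ exp (4 * υ) * exp (4 * (υ' - υ)) :=
          mul_le_mul_of_nonneg_left h1 (exp_pos _).le
      _ = exp (4 * υ') := by rw [← exp_add]; ring_nf
  -- `h(υ') ≥ υ'(4πe^{4υ}(1 + 4(υ'−υ)) − 9.005)` and the latter exceeds `2M`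
  have h1 : υ' * (4 * π * exp (4 * υ) * (1 + 4 * (υ' - υ)) - 9.005) ≤ υ' * (4 * π * exp (4 * υ') - 9.005) := by
    apply mul_le_mul_of_nonneg_left _ hυ'0
    nlinarith [pi_pos, hexp]
  have hE : 4 * π * exp (4 * υ) * υ = 2 * (M : ℝ) + 9 * υ := hυ.2
  have hkey : 2 * (M : ℝ) < υ' * (4 * π * exp (4 * υ) * (1 + 4 * (υ' - υ)) - 9.005) := by
    -- multiply through by `υ > 0` and use `4πe^{4υ}υ = 2M + 9υ`
    have hdiff : υ' - υ = υ / 10 ^ 9 := by rw [hυ']; ring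
    rw [hdiff, hυ']
    have hX : (1 + 1 / 10 ^ 9) * υ * (4 * π * exp (4 * υ) * (1 + 4 * (υ / 10 ^ 9)) - 9.005)
        = (1 + 1 / 10 ^ 9) * ((4 * π * exp (4 * υ) * υ) * (1 + 4 * (υ / 10 ^ 9)) - 9.005 * υ) := by ring
    rw [hX, hE]
    have hMυ : (2 * 10 ^ 18 : ℝ) * (189 / 20) ≤ (M : ℝ) * υ := mul_le_mul hMr hυ.1 (by norm_num) (by positivity)
    nlinarith [hMυ, hυ0, hMr, hυ.1]
  linarith

/-! ## 3. The two-sided window law for `c_M` -/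

/-- **`c_M` against the true mode**: `c_M = a²/(1 + P/(aR))` with prover g4's `|P − (2c/R + 3/a)| ≤ 0.011`,
`0 < c ≤ 2R`, `R ≥ 10¹⁷`; hence `|c_M − a²| ≤ a²/10¹⁶`. -/
theorem abs_cM_sub_xiMode_sq_le (M : ℕ) (hM : 2 * 10 ^ 18 ≤ M) :
    |cM M - xiMode (((2 * M : ℕ)) : ℝ) ^ 2| ≤ xiMode (((2 * M : ℕ)) : ℝ) ^ 2 / 10 ^ 16 := by
  set s : ℕ := 2 * M with hs_def
  have hs : 4 * 10 ^ 18 ≤ s := by omega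
  obtain ⟨ha0, ha, -, -⟩ := mode_facts s hs
  obtain ⟨hApos, -, -, hR0, hc0, hc2, -, -⟩ :=
    consts_facts s hs (A := 4 * π * exp (4 * xiMode (s : ℝ))) (R := _) (c := _) rfl rfl rfl
  have hRbig := R_large s hs (A := 4 * π * exp (4 * xiMode (s : ℝ))) (R := _) (c := _) rfl rfl rfl
  have hP := P_bound s hs (A := 4 * π * exp (4 * xiMode (s : ℝ))) (R := _) (c := _) (P := _) rfl rfl rfl rfl
  set a := xiMode (s : ℝ) with ha_def
  set A := 4 * π * exp (4 * a) with hA_def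
  set R := 4 * A + (s : ℝ) / a ^ 2 with hR_def
  set c := 8 * A - (s : ℝ) / a ^ 3 with hc_def
  set P := a ^ 3 * R * (xiMoment (s - 2) / xiMoment s - 1 / a ^ 2) with hP_def
  have hs2 : s - 2 = 2 * M - 2 := by omega
  have hμ0 : 0 < xiMoment s := xiMoment_pos _
  have hμ2 : 0 < xiMoment (s - 2) := xiMoment_pos _
  -- bounds on P
  obtain ⟨hP1, hP2⟩ := abs_le.mp hP
  have hcR : c / R ≤ 2 := by rw [div_le_iff₀ hR0]; linarith
  have hcR0 : 0 ≤ c / R := div_nonneg hc0.le hR0.le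
  have h3a : 3 / a ≤ 3 / (189 / 20) := div_le_div_of_nonneg_left (by norm_num) (by norm_num) ha
  have h3a0 : 0 ≤ 3 / a := by positivity
  have hPlo : -0.011 ≤ P := by linarith
  have hPhi : P ≤ 4.34 := by linarith
  -- the ratio `μ_{s-2}/μ_s = (1 + P/(aR))/a²`
  have hratio : xiMoment (s - 2) / xiMoment s = (1 + P / (a * R)) / a ^ 2 := by
    rw [hP_def]; field_simp; ring
  have haR : (9.45e17 : ℝ) ≤ a * R := by nlinarith
  have ht : |P / (a * R)| ≤ 4.34 / 9.45e17 := by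
    rw [abs_div, abs_of_pos (by positivity : 0 < a * R)]
    exact div_le_div₀ (by norm_num) (abs_le.mpr ⟨by linarith, hPhi⟩) (by positivity) haR
  have ht' := abs_le.mp ht
  have h1t : 0 < 1 + P / (a * R) := by linarith [ht'.1]
  -- `c_M = a²/(1+t)`
  have hcM : cM M = a ^ 2 / (1 + P / (a * R)) := by
    unfold cM
    rw [← hs_def, ← hs2]
    have : xiMoment s / xiMoment (s - 2) = (xiMoment (s - 2) / xiMoment s)⁻¹ := by
      rw [inv_div]
    rw [this, hratio, inv_div]
  rw [hcM]
  have ha2 : 0 < a ^ 2 := by positivity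
  set t := P / (a * R) with ht_def
  have heq : a ^ 2 / (1 + t) - a ^ 2 = -(a ^ 2 * t) / (1 + t) := by field_simp; ring
  rw [heq, abs_div, abs_neg, abs_mul, abs_of_pos ha2, abs_of_pos h1t, div_le_iff₀ h1t]
  have hbound : |t| ≤ 1 / 10 ^ 17 := ht.trans (by norm_num)
  have htl := ht'.1
  nlinarith [hbound, ha2, abs_nonneg t, mul_le_mul_of_nonneg_left hbound ha2.le]

/-- **The two-sided window law for `c_M` at the envelope mode**: `|c_M − υ²| ≤ υ²/10⁸` for `M ≥ 2·10¹⁸` and the far mode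
`υ` (`4πe^{4υ}υ = 2M + 9υ`, `υ ≥ 189/20`). In particular `|c_M − υ²| ≤ υ²/4000` (S5) and `c_M ≤ (1 + 1/4000)υ²` (S2, S5). -/
theorem abs_cM_sub_sq_le (M : ℕ) (hM : 2 * 10 ^ 18 ≤ M) {υ : ℝ}
    (hυ : (189 / 20 : ℝ) ≤ υ ∧ 4 * π * exp (4 * υ) * υ = 2 * (M : ℝ) + 9 * υ) :
    |cM M - υ ^ 2| ≤ υ ^ 2 / 10 ^ 8 := by
  have h1 := abs_cM_sub_xiMode_sq_le M hM
  have hlo := envMode_le_xiMode M hM hυ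
  have hhi := xiMode_le_envMode_mul M hM hυ
  set a := xiMode (((2 * M : ℕ)) : ℝ) with ha_def
  have hυ0 : 0 < υ := by linarith [hυ.1]
  have ha0 : 0 < a := lt_of_lt_of_le hυ0 hlo
  -- `υ² ≤ a² ≤ (1+10⁻⁹)²υ²`
  have hsq1 : υ ^ 2 ≤ a ^ 2 := pow_le_pow_left₀ hυ0.le hlo 2
  have hsq2 : a ^ 2 ≤ ((1 + 1 / 10 ^ 9) * υ) ^ 2 := pow_le_pow_left₀ ha0.le hhi 2
  obtain ⟨h1l, h1r⟩ := abs_le.mp h1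
  rw [abs_le]
  constructor <;> nlinarith [hsq1, hsq2, hυ0]

/-- `c_M ≤ (1 + 1/4000)·υ²` (the first conjunct of S5 `stub_cubicTransfer`, and S2's disc placement). -/
theorem cM_le (M : ℕ) (hM : 2 * 10 ^ 18 ≤ M) {υ : ℝ}
    (hυ : (189 / 20 : ℝ) ≤ υ ∧ 4 * π * exp (4 * υ) * υ = 2 * (M : ℝ) + 9 * υ) :
    cM M ≤ (1 + 1 / 4000) * υ ^ 2 := by
  have h := (abs_le.mp (abs_cM_sub_sq_le M hM hυ)).2
  have : 0 ≤ υ ^ 2 := sq_nonneg _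
  linarith

/-- `|c_M − υ²| ≤ υ²/4000` (the hypothesis `hc` of `cubicTransfer_of_windowLaws`, p446069). -/
theorem abs_cM_sub_sq_le_4000 (M : ℕ) (hM : 2 * 10 ^ 18 ≤ M) {υ : ℝ}
    (hυ : (189 / 20 : ℝ) ≤ υ ∧ 4 * π * exp (4 * υ) * υ = 2 * (M : ℝ) + 9 * υ) :
    |cM M - υ ^ 2| ≤ υ ^ 2 / 4000 := by
  have h := abs_cM_sub_sq_le M hM hυ
  have : 0 ≤ υ ^ 2 := sq_nonneg _
  exact h.trans (by apply div_le_div_of_nonneg_left this (by norm_num) (by norm_num))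

end Summit.RiemannHypothesis.RiemannHypothesis.Theorems.JensenPolynomials.FarGumbel
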